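import Literature.Algebra.Homology.OrderedCechSystemMap
import Literature.Algebra.Homology.OrderedCechCuts
import HarnessLib

/-!
# The cup product on the ordered Čech complex of systems of modules along a pairing: definition and Leibniz rule
# (Godement, *Topologie algébrique et théorie des faisceaux*, II §6.6; Görtz–Wedhorn II (21.29); Stacks 01FP)

Sequel to `Algebra/Homology/OrderedCechSystem` / `…SystemMap` (the ordered Čech complex `Č•(M)` of a system of
`A`-modules `M : Finset ι ⥤ ModuleCat A` on the finite subsets of a linearly ordered index set, simplices = non-empty
finite subsets, `(d g)_σ = Σ_{a ∈ σ} (-1)^{#{b ∈ σ | b < a}} g_{σ ∖ a}|_σ`).  For three systems `M, N, P` and a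
PAIRING `β = (β_s : M s × N s → P s)_s` of `A`-bilinear maps (natural in `s`, `IsNaturalPairing`), the **cup product**
of ordered (alternating) Čech cochains is the classical front-face/back-face formula

  `(f ∪ g)_{i₀ < ⋯ < i_n} = Σ_{p+q=n} β(f_{i₀ … i_p}|, g_{i_p … i_n}|)`

([Godement1958, II §6.6]; [GortzWedhorn2023, (21.29)]; The Stacks Project, Tag 01FP), written WITHOUT enumerating the
vertices: for an `n`-simplex `σ` and a vertex `v ∈ σ` put `σ_{≤v} = σ.filter (· ≤ v)` and `σ_{≥v} = σ.filter (v ≤ ·)`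
(front face through `v`, back face from `v`; `Algebra/Homology/OrderedCechCuts`); then

  `(f ∪ g)_σ := Σ_{v ∈ σ} β_σ (f.ext0At σ_{≤v} σ) (g.ext0At σ_{≥v} σ)`      (`OrderedCech.cup β p q n`)

where `ext0At` (extension by zero, `OrderedCech.SysCochain.ext0At`) makes the summand vanish unless `#σ_{≤v} = p + 1`
and `#σ_{≥v} = q + 1`, i.e. unless `v` is the `p`-th vertex of `σ` and `p + q = n` — so exactly the one classical term
survives, and no hypothesis `p + q = n` is needed in the DEFINITION.  Main results:

* `cup β p q n : Čᵖ(M) →ₗ Čᵠ(N) →ₗ Čⁿ(P)` (bilinear), `cup_apply`, `ext0At_cup` (compatibility with extension by zero);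
* the vanishing of the summands off the classical term (`ext0At_lowerCut_eq_zero`, `ext0At_upperCut_eq_zero`).

This file holds the DEFINITIONS only; the Leibniz rule `d (f ∪ g) = (d f) ∪ g + (-1)^p • f ∪ (d g)` and its
corollaries (cocycles cup to cocycles; functoriality in the systems) are the sequel
`Algebra/Homology/OrderedCechSystemCupLeibniz`; associativity, units for a system of ALGEBRAS and graded
commutativity in bidegree `(1,1)` follow in `Algebra/Homology/OrderedCechSystemCupAlgebra`; the index combinatorics
(cuts, signs, predecessors) is `Algebra/Homology/OrderedCechCuts`.  Everything here is elementary and proved; no named facts; no geometry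
(the geometric instance `s ↦ Γ(U_s, 𝒪_X)` lives under `AlgebraicGeometry/Modules`).  Mathlib searched (pin v4.32):
`CategoryTheory/Sites/SheafCohomology/Cech` has no products; `AlgebraicTopology` has no simplicial cup product;
`Finset.filter_erase`, `Finset.sum_comm'`, `Finset.sum_nbij'` (used).  Library only (cell hodgecm-mathlib, FLOOR-0 P1
F-11 road A, jobs J3/J4-(iv): the cup product on `Ȟ•(𝓤, 𝒪_A)` of an abelian variety); HC_CM is proved only modulo the
7 printed citations until rung 0 closes, and nothing here bears on it.

## References

* [Godement1958] R. Godement, *Topologie algébrique et théorie des faisceaux*, Hermann (1958), II §6.6 (cup product of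
  Čech cochains, front face / back face).
* [GortzWedhorn2023] U. Görtz, T. Wedhorn, *Algebraic Geometry II: Cohomology of Schemes* (2023), Def. 21.68 (ordered
  Čech complex, p. 180), (21.29) (cup product on Čech cohomology).
* [StacksProject] The Stacks Project, Tag 01FP (cup product on Čech cohomology), Tag 01FG (alternating Čech complex).
-/

universe v u

open CategoryTheory

set_option backward.isDefEq.respectTransparency false

noncomputable section

namespace Literature.Algebra.Homology

namespace OrderedCech

variable {ι : Type} [LinearOrder ι]


/-! ### Pairings of systems and the cup product -/

section Cup

variable {A : Type u} [CommRing A] {M N P : Finset ι ⥤ ModuleCat.{v} A}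

/-- A pairing of systems `β_s : M s × N s → P s` (a family of `A`-bilinear maps) is NATURAL if it commutes with the
restriction maps: `(β_s (x, y))|_t = β_t (x|_t, y|_t)` for `s ⊆ t` — e.g. the multiplication of a system of algebras, or
the action of a system of algebras on a system of modules. [cite: Godement1958, II §6.6] -/
def IsNaturalPairing (β : ∀ s : Finset ι, M.obj s →ₗ[A] N.obj s →ₗ[A] P.obj s) : Prop :=
  ∀ ⦃s t : Finset ι⦄ (h : s ⊆ t) (x : M.obj s) (y : N.obj s),
    (P.map (homOfLE h)).hom (β s x y) = β t ((M.map (homOfLE h)).hom x) ((N.map (homOfLE h)).hom y)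

variable (β : ∀ s : Finset ι, M.obj s →ₗ[A] N.obj s →ₗ[A] P.obj s)

/-- The cup product of a `p`-cochain and a `q`-cochain at a simplex `σ`, as a function:
`Σ_{v ∈ σ} β_σ (f.ext0At σ_{≤v} σ) (g.ext0At σ_{≥v} σ)`. [cite: Godement1958, II §6.6] -/
def cupFun {p q n : ℤ} (f : SysCochain M p) (g : SysCochain N q) : SysCochain P n :=
  fun σ => ∑ v ∈ σ.1, β σ.1 (f.ext0At (Finset.filter (· ≤ v) σ.1) σ.1) (g.ext0At (Finset.filter (v ≤ ·) σ.1) σ.1)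

/-- **The cup product `∪ : Čᵖ(M) × Čᵠ(N) → Čⁿ(P)` along the pairing `β`** (front face / back face, written
through the cuts `σ_{≤v}`, `σ_{≥v}` and extension by zero; bilinear).  For `p + q ≠ n` it is the zero map.
[cite: Godement1958, II §6.6] [cite: GortzWedhorn2023, (21.29)] -/
def cup (p q n : ℤ) : SysCochain M p →ₗ[A] SysCochain N q →ₗ[A] SysCochain P n :=
  LinearMap.mk₂ A (cupFun β)
    (fun f f' g => by
      funext σ
      change cupFun β (f + f') g σ = cupFun β f g σ + cupFun β f' g σ
      simp only [cupFun, SysCochain.ext0At_add, map_add, LinearMap.add_apply, Finset.sum_add_distrib])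
    (fun c f g => by
      funext σ
      change cupFun β (c • f) g σ = c • cupFun β f g σ
      simp only [cupFun, SysCochain.ext0At_smul, map_smul, LinearMap.smul_apply, Finset.smul_sum])
    (fun f g g' => by
      funext σ
      change cupFun β f (g + g') σ = cupFun β f g σ + cupFun β f g' σ
      simp only [cupFun, SysCochain.ext0At_add, map_add, Finset.sum_add_distrib])
    (fun c f g => by
      funext σ
      change cupFun β f (c • g) σ = c • cupFun β f g σ
      simp only [cupFun, SysCochain.ext0At_smul, map_smul, Finset.smul_sum])

/-- The value of the cup product at a simplex. [cite: Godement1958, II §6.6] -/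
theorem cup_apply {p q n : ℤ} (f : SysCochain M p) (g : SysCochain N q) (σ : Simplex ι n) :
    cup β p q n f g σ = ∑ v ∈ σ.1, β σ.1 (f.ext0At (Finset.filter (· ≤ v) σ.1) σ.1) (g.ext0At (Finset.filter (v ≤ ·) σ.1) σ.1) := rfl

variable {β}

/-- **Extension by zero of a cup product**: for a natural pairing, an `n`-simplex `s` and `s ⊆ t`,
`(f ∪ g).ext0At s t = Σ_{v ∈ s} β_t (f.ext0At s_{≤v} t) (g.ext0At s_{≥v} t)`. [cite: Godement1958, II §6.6] -/
theorem ext0At_cup (hβ : IsNaturalPairing β) {p q n : ℤ} (f : SysCochain M p) (g : SysCochain N q)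
    (s t : Finset ι) (hs : s.Nonempty ∧ (s.card : ℤ) = n + 1) (hst : s ⊆ t) :
    (cup β p q n f g).ext0At s t = ∑ v ∈ s, β t (f.ext0At (Finset.filter (· ≤ v) s) t) (g.ext0At (Finset.filter (v ≤ ·) s) t) := by
  rw [SysCochain.ext0At_val (cup β p q n f g) ⟨s, hs⟩ t hst, cup_apply, map_sum]
  refine Finset.sum_congr rfl fun v _ => ?_
  rw [hβ hst, SysCochain.map_ext0At _ _ _ _ (lowerCut_subset s v) hst,
    SysCochain.map_ext0At _ _ _ _ (upperCut_subset s v) hst]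

/-- A summand of the cup product vanishes unless the front face has exactly `p + 1` vertices. [folklore] [cite: Godement1958, II §6.6] -/
theorem ext0At_lowerCut_eq_zero {p : ℤ} (f : SysCochain M p) (s t : Finset ι) (v : ι)
    (h : ((Finset.filter (· ≤ v) s).card : ℤ) ≠ p + 1) : f.ext0At (Finset.filter (· ≤ v) s) t = 0 := by
  unfold SysCochain.ext0At
  rw [dif_neg]
  exact fun h' => h h'.1.2

/-- A summand of the cup product vanishes unless the back face has exactly `q + 1` vertices. [folklore] [cite: Godement1958, II §6.6] -/
theorem ext0At_upperCut_eq_zero {q : ℤ} (g : SysCochain N q) (s t : Finset ι) (v : ι)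
    (h : ((Finset.filter (v ≤ ·) s).card : ℤ) ≠ q + 1) : g.ext0At (Finset.filter (v ≤ ·) s) t = 0 := by
  unfold SysCochain.ext0At
  rw [dif_neg]
  exact fun h' => h h'.1.2

end Cup

end OrderedCech

end Literature.Algebra.Homology

end
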